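import Literature.NumberTheory.GaloisRepresentations.LocalUnramifiedBrauer
import Mathlib.Data.ZMod.QuotientGroup
import HarnessLib

/-!
# `Br(L/K)` is cyclic, generated by the unramified class (Serre, *Corps locaux* XIII §3 Prop. 7)

Continuation of `LocalUnramifiedBrauer.lean` (same frame: `F` a non-archimedean local field of
characteristic `0`, `L₁/F` finite Galois inside `F̄` containing the unramified level `F_m`,
subgroups `D_L ≤ D ≤ Gal(L₁/F)` with fixed fields `K ⊆ L`).

* `resSub_cyclicClass_eq_zero` — **the unramified class of `K` dies in `L`** when
  `m = [L : K] f_K`: for a cyclic layer `θ : Γ_K → ℤ/d` with kernel `Γ_{K_m}` and a uniformiser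
  `π_K`, `res_{Γ_L} κ_θ(π_K) = 0`.  Proof: `res κ_θ(π_K) = κ_ψ(π_K)` for the derived character
  `ψ : Γ_L → ℤ/e` of `θ|_{Γ_L}` (`map_cyclicClass_eq_cyclicClass_derived`), whose kernel is
  `Γ_{L_m}` and whose order is `e = m / f_L = e(L/K)`; writing `π_K = w π_L^e` with `w` a unit of
  `L` (`exists_eq_mul_pow_of_tVal_eq`), `κ_ψ(w) = 0` (units are norms from `L_m`,
  `cyclicClass_eq_zero_of_dvd_tVal`) and `e κ_ψ(π_L) = 0` (`nsmul_cyclicClass_eq_zero`).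
* `exists_resKer_eq_zmultiples` — **`Br(L/K) = ker(H²(Γ_K, F̄ˣ) → H²(Γ_L, F̄ˣ))` is cyclic of
  order `[L : K]`, generated by the unramified class `κ_θ(π_K)`** (`L/K` Galois, `m = [L:K] f_K`):
  the class lies in `Br(L/K)` (above), has order exactly `[L : K]`
  (`div_dvd_of_nsmul_cyclicClass_eq_zero`), and `|Br(L/K)| ≤ [L : K]`
  (`natCard_resKer_le_relIndex` with the norm index theorem
  `normIndex_eq_finrank_of_isNonarchimedeanLocalField`).

## References
* J.-P. Serre, *Corps locaux*, Hermann, 1968, XIII §3 Prop. 7 and Cor. 1–3. [SerreLocalFields1979]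
-/

noncomputable section

open CategoryTheory Function
open Field IsNonarchimedeanLocalField ValuativeRel IntermediateField

universe u

namespace Literature.NumberTheory.GaloisRepresentations

open _root_.TopRep _root_.ContRepresentation _root_.ContinuousCohomology DiscreteGaloisModule
open LocalWeilDatum

section Frame

variable (F : Type u) [Field F] [ValuativeRel F] [TopologicalSpace F] [IsNonarchimedeanLocalField F]
  [CharZero F]
variable (L₁ : IntermediateField F (AlgebraicClosure F)) [FiniteDimensional F L₁] [IsGalois F L₁]

attribute [local instance] compactSpace_of_isClosed_subgroup isClosed_layerN

/-! ### Degrees of the fixed fields -/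

omit [ValuativeRel F] [TopologicalSpace F] [IsNonarchimedeanLocalField F] [CharZero F]
  [FiniteDimensional F L₁] [IsGalois F L₁] in
/-- `D_L ≤ D` gives `K ≤ L` for the fixed fields. [folklore] -/
theorem fieldOf_mono {X X' : Subgroup (L₁ ≃ₐ[F] L₁)} (h : X' ≤ X) : fieldOf F L₁ X ≤ fieldOf F L₁ X' := by
  intro z hz
  have hzL : z ∈ L₁ := fieldOf_le F L₁ X hz
  have hx : (⟨z, hzL⟩ : L₁) ∈ fixedField X := (mem_lift ⟨z, hzL⟩).1 hz
  have hx' : (⟨z, hzL⟩ : L₁) ∈ fixedField X' := fixedField_antitone h hx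
  exact (mem_lift ⟨z, hzL⟩).2 hx'

omit [ValuativeRel F] [TopologicalSpace F] [IsNonarchimedeanLocalField F] [CharZero F]
  [IsGalois F L₁] in
/-- **`[K : F] · |D| = [L₁ : F]`** for `K = L₁^D`. [folklore] -/
theorem finrank_fieldOf_mul_card (X : Subgroup (L₁ ≃ₐ[F] L₁)) :
    Module.finrank F (fieldOf F L₁ X) * Nat.card X = Module.finrank F L₁ := by
  rw [← (liftAlgEquiv (fixedField X)).toLinearEquiv.finrank_eq, ← finrank_fixedField_eq_card X,
    Module.finrank_mul_finrank]

omit [ValuativeRel F] [TopologicalSpace F] [IsNonarchimedeanLocalField F] [CharZero F]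
  [IsGalois F L₁] in
/-- **`[L : K] = (D : D_L)`** for the fixed fields `K ⊆ L` of `D_L ≤ D`. [folklore] -/
theorem finrank_fieldOf_fieldOf {X X' : Subgroup (L₁ ≃ₐ[F] L₁)} (h : X' ≤ X) :
    letI := towerAlgebra (fieldOf_mono F L₁ h)
    Module.finrank (fieldOf F L₁ X) (fieldOf F L₁ X') = X'.relIndex X := by
  letI := towerAlgebra (fieldOf_mono F L₁ h)
  haveI := towerAlgebra_isScalarTower_bot (F := F) (fieldOf_mono F L₁ h)
  have h1 := finrank_fieldOf_mul_card F L₁ X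
  have h2 := finrank_fieldOf_mul_card F L₁ X'
  have h3 : X'.relIndex X * Nat.card X' = Nat.card X := by
    rw [Subgroup.relIndex, mul_comm, ← Nat.card_congr (Subgroup.subgroupOfEquivOfLe h).toEquiv,
      Subgroup.card_mul_index]
  have h4 := Module.finrank_mul_finrank F (fieldOf F L₁ X) (fieldOf F L₁ X')
  have hpos : 0 < Module.finrank F (fieldOf F L₁ X) := Module.finrank_pos
  have hpos' : 0 < Nat.card X' := Nat.card_pos
  apply Nat.eq_of_mul_eq_mul_right hpos'
  apply Nat.eq_of_mul_eq_mul_left hpos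
  rw [← mul_assoc, h4, h2, h3, h1]

/-! ### Invariants from field elements -/

variable {L₁}

/-- **A nonzero element of `K = L₁^D` as an `N`-invariant of `F̄ˣ`.** [folklore] -/
def invOfField {X : Subgroup (L₁ ≃ₐ[F] L₁)} (x : fieldOf F L₁ X) (hx : x ≠ 0) :
    (layerRep L₁ X).toTopRep.ρ.invariants :=
  ⟨UnitsCarrier.ofUnits (Units.mk0 (x : AlgebraicClosure F) fun h => hx (Subtype.ext h)), fun g => by
    apply unitsVal_injective F
    apply Units.ext
    rw [ContinuousRep.toTopRep_ρ_apply, ContinuousRep.restrict_apply, subgroupIncl_apply,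
      unitsVal_apply, Units.coe_smul, unitsVal_ofUnits]
    have hg : (g : absoluteGaloisGroup F) ∈ galFixing F (fieldOf F L₁ X) := by
      rw [← layerN_eq_galFixing]
      exact g.2
    exact (mem_galFixing_iff F).1 hg x x.2⟩

omit [ValuativeRel F] [TopologicalSpace F] [IsNonarchimedeanLocalField F] [CharZero F] in
/-- `invOfField x` is `x` in `F̄`. [folklore] -/
@[simp] theorem coe_unitsVal_invOfField {X : Subgroup (L₁ ≃ₐ[F] L₁)} (x : fieldOf F L₁ X) (hx : x ≠ 0) :
    ((unitsVal F ((invOfField F x hx : (layerRep L₁ X).toTopRep.ρ.invariants) : UnitsCarrier F) :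
      (AlgebraicClosure F)ˣ) : AlgebraicClosure F) = x := rfl

omit [ValuativeRel F] [TopologicalSpace F] [IsNonarchimedeanLocalField F] in
/-- `kUnit (invOfField x) = x`. [folklore] -/
@[simp] theorem kUnit_invOfField {X : Subgroup (L₁ ≃ₐ[F] L₁)} (x : fieldOf F L₁ X) (hx : x ≠ 0) :
    kUnit F L₁ X (invOfField F x hx) = Units.mk0 x hx :=
  Units.ext (Subtype.ext rfl)

/-! ### The unramified class of `K` dies in `L` -/

variable {D D_L : Subgroup (L₁ ≃ₐ[F] L₁)} {m : ℕ}

/-- **`res_{Γ_L} κ_θ(π_K) = 0` for `m = [L : K] f_K`**: see the module docstring.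
[cite: SerreLocalFields1979, XIII §3 Prop. 7] -/
theorem resSub_cyclicClass_eq_zero (hDL : D_L ≤ D) (hm : 0 < m) (hmL : unramifiedLevel F m ≤ L₁)
    (hmKL : letI := towerAlgebra (fieldOf_mono F L₁ hDL)
      m = Module.finrank (fieldOf F L₁ D) (fieldOf F L₁ D_L) * fDeg F (fieldOf F L₁ D))
    {d : ℕ} [NeZero d] (θ : CyclicCharacter (layerN L₁ D) d)
    (hθ : θ.ker = layerS L₁ D (unrLayer F L₁ D m)) (a : (layerRep L₁ D).toTopRep.ρ.invariants)
    (hta : tVal F (fieldOf F L₁ D) (kUnit F L₁ D a : fieldOf F L₁ D) = fDeg F (fieldOf F L₁ D)) :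
    resSub (units F) (Subgroup.comap_mono hDL : layerN L₁ D_L ≤ layerN L₁ D) 2
      (cyclicClass θ (layerRep L₁ D) a) = 0 := by
  classical
  letI := towerAlgebra (fieldOf_mono F L₁ hDL)
  have hKL : fieldOf F L₁ D ≤ fieldOf F L₁ D_L := fieldOf_mono F L₁ hDL
  have hle : layerN L₁ D_L ≤ layerN L₁ D := Subgroup.comap_mono hDL
  have hsepK := le_sepClosure_of_charZero F (fieldOf F L₁ D)
  have hsepL := le_sepClosure_of_charZero F (fieldOf F L₁ D_L)
  -- degrees: `f_L ∣ m = e' f_L`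
  have he' : eRel F (fieldOf F L₁ D) hKL * fDeg F (fieldOf F L₁ D_L) = m := by
    rw [eRel_mul_fDeg F (fieldOf F L₁ D) hKL hsepK hsepL, hmKL]
  have hfL : fDeg F (fieldOf F L₁ D_L) ∣ m := ⟨_, by rw [← he', mul_comm]⟩
  -- the derived character of `θ|_{Γ_L}`, its kernel and order
  let ψ := θ.derived (inclHom hle)
  have hψ : ψ.ker = layerS L₁ D_L (unrLayer F L₁ D_L m) := by
    rw [CyclicCharacter.ker_derived, hθ]
    ext t
    simp only [Subgroup.mem_comap, Subgroup.mem_subgroupOf, unrLayer, Subgroup.mem_inf]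
    change ((t : layerN L₁ D_L) : absoluteGaloisGroup F) ∈ layerN' L₁ (D ⊓ unrSub F L₁ m) ↔
      ((t : layerN L₁ D_L) : absoluteGaloisGroup F) ∈ layerN' L₁ (D_L ⊓ unrSub F L₁ m)
    simp only [layerN', Subgroup.mem_comap, Subgroup.mem_inf]
    exact ⟨fun h => ⟨t.2, h.2⟩, fun h => ⟨hDL t.2, h.2⟩⟩
  haveI := normal_layerN'_subgroupOf L₁ (unrLayer_le F L₁ D_L m) (normal_unrLayer F L₁ D_L hm)
  have he : θ.compOrder (inclHom hle) = eRel F (fieldOf F L₁ D) hKL := by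
    have h1 : θ.compOrder (inclHom hle) = m / fDeg F (fieldOf F L₁ D_L) := by
      rw [CyclicCharacter.compOrder_eq_index, ← CyclicCharacter.ker_derived]
      change ψ.ker.index = _
      rw [hψ, Subgroup.index_eq_card]
      exact natCard_quot_unrLayer F L₁ D_L hm hmL hfL
    rw [h1, ← he', Nat.mul_div_cancel _ (fDeg_pos F _)]
  -- the decomposition `π_K = w π_L^{e'}` in `L`
  obtain ⟨πL, hπ0, htπ⟩ := exists_tVal_eq_fDeg F (fieldOf F L₁ D_L) hsepL
  obtain ⟨w, hw0, htw, hdec⟩ := exists_eq_mul_pow_of_tVal_eq F (fieldOf F L₁ D) hKL hsepK hsepL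
    (kUnit F L₁ D a).ne_zero hta hπ0 htπ
  let a' : (layerRep L₁ D_L).toTopRep.ρ.invariants := ⟨(a : UnitsCarrier F), fun g => a.2 ⟨g.1, hle g.2⟩⟩
  have ha' : a' = invOfField F w hw0 + eRel F (fieldOf F L₁ D) hKL • invOfField F πL hπ0 := by
    apply Subtype.ext
    apply unitsVal_injective F
    apply Units.ext
    rw [AddMemClass.coe_add, AddSubmonoidClass.coe_nsmul, unitsVal_add, unitsVal_nsmul,
      Units.val_mul, Units.val_pow_eq_pow_val, coe_unitsVal_invOfField, coe_unitsVal_invOfField]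
    have h := congrArg (fun x : fieldOf F L₁ D_L => (x : AlgebraicClosure F)) hdec
    simp only [MulMemClass.coe_mul, SubmonoidClass.coe_pow] at h
    exact h
  -- restriction = cyclic class of the derived character
  have hres : resSub (units F) hle 2 (cyclicClass θ (layerRep L₁ D) a) =
      cyclicClass ψ (layerRep L₁ D_L) a' :=
    map_cyclicClass_eq_cyclicClass_derived θ (inclHom hle) (layerRep L₁ D) (layerRep L₁ D_L)
      (resSubMod (units F) hle) (fun _ => rfl) a a' rfl
  rw [hres, ha', map_add, map_nsmul]
  have h1 : cyclicClass ψ (layerRep L₁ D_L) (invOfField F w hw0) = 0 :=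
    cyclicClass_eq_zero_of_dvd_tVal F L₁ hm hmL hfL ψ hψ _ (by
      rw [kUnit_invOfField, Units.val_mk0, htw]
      exact dvd_zero _)
  have h2 : eRel F (fieldOf F L₁ D) hKL • cyclicClass ψ (layerRep L₁ D_L) (invOfField F πL hπ0) = 0 := by
    rw [← he]
    exact nsmul_cyclicClass_eq_zero ψ (layerRep L₁ D_L) _
  rw [h1, h2, add_zero]

/-! ### `Br(L/K)` is cyclic, generated by the unramified class -/

/-- **`Br(L/K)` is cyclic of order `[L : K]`, generated by the unramified class `κ_θ(π_K)`** for
`L/K` Galois (`D_L ⊴ D`) and `m = [L : K] f_K` with `F_m ≤ L₁`: see the module docstring.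
[cite: SerreLocalFields1979, XIII §3 Prop. 7 and Cor. 2] -/
theorem exists_resKer_eq_zmultiples (hDL : D_L ≤ D) (hn : (D_L.subgroupOf D).Normal) (hm : 0 < m)
    (hmL : unramifiedLevel F m ≤ L₁) (hmK : m = D_L.relIndex D * fDeg F (fieldOf F L₁ D)) :
    ∃ u : continuousCohomology 2 (layerRep L₁ D).toTopRep,
      resKer (units F) (layerN'_le L₁ hDL) = AddSubgroup.zmultiples u ∧
        addOrderOf u = D_L.relIndex D ∧ Finite (resKer (units F) (layerN'_le L₁ hDL)) := by
  classical
  have hfK : fDeg F (fieldOf F L₁ D) ∣ m := ⟨_, by rw [hmK, mul_comm]⟩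
  have hdN : m / fDeg F (fieldOf F L₁ D) = D_L.relIndex D := by
    rw [hmK, Nat.mul_div_cancel _ (fDeg_pos F _)]
  have hN0 : D_L.relIndex D ≠ 0 := by
    rw [Subgroup.relIndex, Subgroup.index_eq_card]
    exact Nat.card_pos.ne'
  haveI : NeZero (m / fDeg F (fieldOf F L₁ D)) := ⟨by rw [hdN]; exact hN0⟩
  -- the unramified character and the class of a uniformiser
  obtain ⟨θ, hθ⟩ := exists_unrChar F L₁ hm hmL hfK
  obtain ⟨πK, hπ0, htπ⟩ := exists_tVal_eq_fDeg F (fieldOf F L₁ D) (le_sepClosure_of_charZero F _)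
  have hta : tVal F (fieldOf F L₁ D) (kUnit F L₁ D (invOfField F πK hπ0) : fieldOf F L₁ D) =
      fDeg F (fieldOf F L₁ D) := by
    rw [kUnit_invOfField, Units.val_mk0]
    exact htπ
  -- it lies in `Br(L/K)`
  have hmKL : letI := towerAlgebra (fieldOf_mono F L₁ hDL)
      m = Module.finrank (fieldOf F L₁ D) (fieldOf F L₁ D_L) * fDeg F (fieldOf F L₁ D) := by
    rw [finrank_fieldOf_fieldOf F L₁ hDL]
    exact hmK
  have hu : cyclicClass θ (layerRep L₁ D) (invOfField F πK hπ0) ∈ resKer (units F) (layerN'_le L₁ hDL) :=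
    (mem_resKer _ _ _).2 (resSub_cyclicClass_eq_zero F hDL hm hmL hmKL θ hθ _ hta)
  -- of order exactly `[L : K]`
  have hord : addOrderOf (cyclicClass θ (layerRep L₁ D) (invOfField F πK hπ0)) = D_L.relIndex D := by
    rw [← hdN]
    refine Nat.dvd_antisymm (addOrderOf_dvd_of_nsmul_eq_zero (nsmul_cyclicClass_eq_zero θ _ _)) ?_
    by_cases h1 : m / fDeg F (fieldOf F L₁ D) = 1
    · exact (Nat.dvd_one.2 h1).trans (one_dvd _)
    · haveI : Fact (1 < m / fDeg F (fieldOf F L₁ D)) :=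
        ⟨lt_of_le_of_ne NeZero.one_le (Ne.symm h1)⟩
      exact div_dvd_of_nsmul_cyclicClass_eq_zero F L₁ hm hmL hfK θ hθ _ hta (addOrderOf_nsmul_eq_zero _)
  -- and `|Br(L/K)| ≤ [L : K]`
  obtain ⟨hfin, hcard⟩ := natCard_resKer_le_relIndex L₁
    (normIndex_eq_finrank_of_isNonarchimedeanLocalField F) hDL hn
  haveI := hfin
  refine ⟨cyclicClass θ (layerRep L₁ D) (invOfField F πK hπ0), ?_, hord, hfin⟩
  symm
  apply AddSubgroup.eq_of_le_of_card_ge ((AddSubgroup.zmultiples_le).2 hu)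
  rw [Nat.card_zmultiples, hord]
  exact hcard

end Frame

end Literature.NumberTheory.GaloisRepresentations

end
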